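import Summits.AtomisticToContinuum.FouriersLaw.Theorems.BondHeatUncertaintyBoundedResponseTransientBandC

/-!
# `TransientBand` — the blocker `BoundedResponse` (11071) split at the Thouless time by the escape transient (lens-1 g92 node B) — part 4 of 5 (sequel of `…BondHeatUncertaintyBoundedResponseTransientBandC`)

Split for the 400-line cap by the landing lane (hand-2 g35); the module docstring of part 1 (`…BondHeatUncertaintyBoundedResponseTransientBandA`) describes the whole node.  Same namespace; all FQNs unchanged.
0 sorry; standard axioms.
-/

noncomputable section
open MeasureTheory Filter Topology Set
open Literature.MathematicalPhysics.KineticTheory.HeatConduction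

namespace Summit.AtomisticToContinuum.FouriersLaw.Theorems.BoundedResponse.TransientBand

open Summit.AtomisticToContinuum.FouriersLaw.Theses.BondHeatUncertainty (BoundedResponse)
open Summit.AtomisticToContinuum.FouriersLaw.Theses.GriffithsLimitExchange (BoundaryDEP)
open Summit.AtomisticToContinuum.FouriersLaw.Theorems.SubdiffusiveBondHeat
  (boundaryKernelBasics_proof pinnedChain_primitive_kinKernel_integral_eq escapeDeficit_nonneg escapeDeficit_le_one
    boundedResponse_iff_ohmicFloor)
open Summit.AtomisticToContinuum.FouriersLaw.Theorems.SubdiffusiveBondHeat.EscapeGrading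
  (escapeDeficit OhmicFloor ExponentFloor ohmicFloor_iff_boundedResponse exponentFloor_one_iff_ohmicFloor)
open Summit.AtomisticToContinuum.FouriersLaw.Theorems.BoundedResponse.TransientContact (contactImbalanceCorr)
open Summit.AtomisticToContinuum.FouriersLaw.Theorems.SubdiffusiveBondHeat

/-! ### The high band is free: Bochner positivity + a Fejér average (abstract kernel)

For a measurable kernel `K ∈ L¹(0,∞)` with `|K| ≤ B₀` which is positive-definite in Fejér form
(`0 ≤ ∫₀ᵗ (t − r) cos(ωr) K(r) dr` for all `ω`, `t ≥ 0` — automatic for a stationary autocorrelation), the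
cosine transform `Ĉ(ω) = ∫_{(0,∞)} cos(ωu) K(u) du` is nonnegative (Bochner, easy direction), and the
Fejér average `∫₀² [∫ (1 − cos ωs) ω⁻² Ĉ(ω) dω] ds = c₁ ∫₀² ∫₀ˢ (s − u) K(u) du ds` controls
`∫_{(1,∞)} ω⁻² Ĉ(ω) dω ≤ 8c₁B₀`; hence the high-band part of the surplus spectrum obeys
`∫_{(1,∞)} (1 − cos ωt) ω⁻² D_K(ω) dω ≥ −16 c₁ B₀` with `D_K = Ĉ(0) − Ĉ`. -/

section HighBandFree

variable {K : ℝ → ℝ} (hKm : Measurable K) (hKi : IntegrableOn K (Ioi 0))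
include hKi

/-- `cos(ω·) K ∈ L¹(0,∞)`. [folklore] -/
theorem integrableOn_cos_mul_kernel (ω : ℝ) :
    IntegrableOn (fun u : ℝ => Real.cos (ω * u) * K u) (Ioi 0) := by
  have hcc : Continuous fun u : ℝ => Real.cos (ω * u) := by fun_prop
  refine Integrable.bdd_mul (c := 1) hKi hcc.aestronglyMeasurable.restrict
    (Eventually.of_forall fun u => ?_)
  rw [Real.norm_eq_abs]; exact Real.abs_cos_le_one _

/-- `|Ĉ(ω)| ≤ ∫_{(0,∞)} |K|`. [folklore] -/
theorem abs_cosTransform_le (ω : ℝ) :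
    |∫ u in Ioi 0, Real.cos (ω * u) * K u| ≤ ∫ u in Ioi 0, |K u| := by
  have h1 : |∫ u in Ioi 0, Real.cos (ω * u) * K u| ≤ ∫ u in Ioi 0, |Real.cos (ω * u) * K u| := by
    simpa only [Real.norm_eq_abs] using
      norm_integral_le_integral_norm (μ := volume.restrict (Ioi 0))
        (fun u : ℝ => Real.cos (ω * u) * K u)
  refine h1.trans (integral_mono_of_nonneg (Eventually.of_forall fun u => abs_nonneg _) hKi.abs
    (Eventually.of_forall fun u => ?_))
  simp only [abs_mul]
  calc |Real.cos (ω * u)| * |K u| ≤ 1 * |K u| :=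
        mul_le_mul_of_nonneg_right (Real.abs_cos_le_one _) (abs_nonneg _)
    _ = |K u| := one_mul _

/-- `D_K(ω) = Ĉ(0-form) − Ĉ(ω)`: `∫ (1 − cos ωu) K = ∫ K − ∫ cos(ωu) K`. [folklore] -/
theorem dip_eq_sub_cosTransform (ω : ℝ) :
    ∫ u in Ioi 0, (1 - Real.cos (ω * u)) * K u =
      (∫ u in Ioi 0, K u) - ∫ u in Ioi 0, Real.cos (ω * u) * K u := by
  rw [← integral_sub hKi (integrableOn_cos_mul_kernel hKi ω)]
  refine integral_congr_ae (Eventually.of_forall fun u => ?_)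
  ring

include hKm

omit hKi in
/-- `Ĉ` is measurable in the frequency. [folklore] -/
theorem measurable_cosTransform :
    Measurable fun ω : ℝ => ∫ u in Ioi 0, Real.cos (ω * u) * K u := by
  have h : Measurable fun p : ℝ × ℝ => Real.cos (p.1 * p.2) * K p.2 :=
    (by fun_prop : Measurable fun p : ℝ × ℝ => Real.cos (p.1 * p.2)).mul (hKm.comp measurable_snd)
  exact (h.stronglyMeasurable.integral_prod_right'
    (ν := (volume : Measure ℝ).restrict (Ioi 0))).measurable

omit hKm in
/-- **Bochner, easy direction (abstract)**: a bounded `L¹` kernel positive-definite in Fejér form has a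
nonnegative cosine transform at every frequency. [folklore] -/
theorem cosTransform_nonneg_of_lagIntegral_nonneg (hKm : Measurable K) {B₀ : ℝ}
    (hKb : ∀ u, |K u| ≤ B₀)
    (hpos : ∀ ω t : ℝ, 0 ≤ t → 0 ≤ ∫ r in (0 : ℝ)..t, (t - r) * (Real.cos (ω * r) * K r))
    (ω : ℝ) : 0 ≤ ∫ u in Ioi 0, Real.cos (ω * u) * K u := by
  have hcm : Measurable fun u : ℝ => Real.cos (ω * u) := by fun_prop
  have hgm : Measurable fun u : ℝ => Real.cos (ω * u) * K u := hcm.mul hKm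
  have hgB : ∀ u : ℝ, |Real.cos (ω * u) * K u| ≤ B₀ := fun u => by
    rw [abs_mul]
    calc |Real.cos (ω * u)| * |K u| ≤ 1 * B₀ :=
          mul_le_mul (Real.abs_cos_le_one _) (hKb u) (abs_nonneg _) zero_le_one
      _ = B₀ := one_mul _
  exact integral_Ioi_nonneg_of_lagIntegral_nonneg hgm hgB (integrableOn_cos_mul_kernel hKi ω)
    (hpos ω)

/-- **Fejér identity in the frequency domain**: for `s ≥ 0`,
`∫_{(0,∞)} (1 − cos ωs) ω⁻² Ĉ(ω) dω = c₁ ∫₀ˢ (s − u) K(u) du`. [folklore] -/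
theorem integral_fejer_mul_cosTransform {s : ℝ} (hs : 0 ≤ s) :
    ∫ ω in Ioi (0 : ℝ), (1 - Real.cos (ω * s)) / ω ^ 2 * ∫ u in Ioi 0, Real.cos (ω * u) * K u =
      (∫ ω in Ioi (0 : ℝ), (1 - Real.cos ω) / ω ^ 2) * ∫ u in (0 : ℝ)..s, (s - u) * K u := by
  set c₁ : ℝ := ∫ ω in Ioi (0 : ℝ), (1 - Real.cos ω) / ω ^ 2 with hc₁
  set I₀ : ℝ := ∫ u in Ioi 0, K u with hI₀
  have hC : ∀ ω, ∫ u in Ioi 0, Real.cos (ω * u) * K u =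
      I₀ - ∫ u in Ioi 0, (1 - Real.cos (ω * u)) * K u := fun ω => by
    rw [dip_eq_sub_cosTransform hKi ω]; ring
  simp_rw [hC, mul_sub]
  rw [integral_sub ((integrableOn_one_sub_cos_mul_div_sq hs).mul_const I₀)
    (integrableOn_spectralIntegrand hKm hKi hs), integral_mul_const,
    integral_one_sub_cos_mul_div_sq hs, ← integral_min_mul_eq_spectral hKm hKi hs,
    integral_min_mul_eq_sub hKi hs]
  ring

omit hKm hKi in
/-- The Fejér weight on the averaging window: `(1 − cos ωs)/ω² ≤ 4/(1 + ω²)` for `0 ≤ s ≤ 2`, `ω > 0`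
(`1 − cos x ≤ x²/2` and `≤ 2`). [folklore] -/
theorem fejerWeight_le {s ω : ℝ} (hs0 : 0 ≤ s) (hs : s ≤ 2) (hω : 0 < ω) :
    (1 - Real.cos (ω * s)) / ω ^ 2 ≤ 4 * (1 + ω ^ 2)⁻¹ := by
  have h1 := one_sub_cos_mem_Icc (ω * s)
  have h2 : 1 - Real.cos (ω * s) ≤ (ω * s) ^ 2 / 2 := by
    have := Real.one_sub_sq_div_two_le_cos (x := ω * s); linarith
  have hω2 : 0 < ω ^ 2 := by positivity
  rw [div_le_iff₀ hω2, show 4 * (1 + ω ^ 2)⁻¹ * ω ^ 2 = 4 * ω ^ 2 / (1 + ω ^ 2) by ring,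
    le_div_iff₀ (by positivity)]
  have hs2 : s ^ 2 ≤ 4 := by nlinarith
  nlinarith [h1.1, h1.2, mul_le_mul_of_nonneg_left hs2 hω2.le]

omit hKm hKi in
/-- `∫_{(0,2]} (1 − cos ωs)/ω² ds = (2 − sin(2ω)/ω)/ω²` for `ω ≠ 0`. [folklore] -/
theorem integral_Ioc_fejerWeight {ω : ℝ} (hω : ω ≠ 0) :
    ∫ s in Ioc (0 : ℝ) 2, (1 - Real.cos (ω * s)) / ω ^ 2 = (2 - Real.sin (2 * ω) / ω) / ω ^ 2 := by
  rw [← intervalIntegral.integral_of_le (by norm_num : (0 : ℝ) ≤ 2), intervalIntegral.integral_div,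
    intervalIntegral.integral_sub
      ((by fun_prop : Continuous fun _ : ℝ => (1 : ℝ)).intervalIntegrable _ _)
      ((by fun_prop : Continuous fun s : ℝ => Real.cos (ω * s)).intervalIntegrable _ _),
    intervalIntegral.integral_const, intervalIntegral.integral_comp_mul_left _ hω, integral_cos]
  simp only [sub_zero, smul_eq_mul, mul_one, mul_zero, Real.sin_zero]
  congr 1
  rw [mul_comm ω 2]
  field_simp

omit hKm hKi in
/-- On `ω ≥ 1`: `1 ≤ 2 − sin(2ω)/ω`. [folklore] -/
theorem one_le_two_sub_sin_div {ω : ℝ} (hω : 1 ≤ ω) : 1 ≤ 2 - Real.sin (2 * ω) / ω := by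
  have hω0 : 0 < ω := by linarith
  have h : Real.sin (2 * ω) / ω ≤ 1 := by
    rw [div_le_one hω0]
    exact (Real.sin_le_one _).trans hω
  linarith

/-- The Fejér-averaged double integrand `(s, ω) ↦ (1 − cos ωs) ω⁻² Ĉ(ω)` is integrable on
`(0,2] × (0,∞)` (dominated by `4‖K‖₁/(1 + ω²)`). [folklore] -/
theorem integrable_fejerAverage :
    Integrable (fun p : ℝ × ℝ =>
        (1 - Real.cos (p.2 * p.1)) / p.2 ^ 2 * ∫ u in Ioi 0, Real.cos (p.2 * u) * K u)
      (((volume : Measure ℝ).restrict (Ioc 0 2)).prod ((volume : Measure ℝ).restrict (Ioi 0))) := by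
  set L : ℝ := ∫ u in Ioi 0, |K u| with hL
  have hGm : Measurable fun p : ℝ × ℝ =>
      (1 - Real.cos (p.2 * p.1)) / p.2 ^ 2 * ∫ u in Ioi 0, Real.cos (p.2 * u) * K u := by
    have h1 : Measurable fun p : ℝ × ℝ => (1 - Real.cos (p.2 * p.1)) / p.2 ^ 2 := by fun_prop
    exact h1.mul ((measurable_cosTransform hKm).comp measurable_snd)
  have hDi : Integrable (fun p : ℝ × ℝ => (1 : ℝ) * (4 * (1 + p.2 ^ 2)⁻¹ * L))
      (((volume : Measure ℝ).restrict (Ioc 0 2)).prod ((volume : Measure ℝ).restrict (Ioi 0))) := by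
    refine Integrable.mul_prod (f := fun _ : ℝ => (1 : ℝ)) (g := fun ω : ℝ => 4 * (1 + ω ^ 2)⁻¹ * L)
      ?_ ?_
    · exact integrableOn_const (by simp)
    · exact ((integrable_inv_one_add_sq.const_mul 4).mul_const L).integrableOn
  rw [Measure.prod_restrict] at hDi ⊢
  refine hDi.mono' hGm.aestronglyMeasurable ((ae_restrict_iff' (measurableSet_Ioc.prod
    measurableSet_Ioi)).2 (Eventually.of_forall fun p hp => ?_))
  rw [Set.mem_prod] at hp
  have hF0 : 0 ≤ (1 - Real.cos (p.2 * p.1)) / p.2 ^ 2 :=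
    div_nonneg (one_sub_cos_mem_Icc _).1 (sq_nonneg _)
  rw [Real.norm_eq_abs, abs_mul, abs_of_nonneg hF0, one_mul]
  exact mul_le_mul (fejerWeight_le hp.1.1.le hp.1.2 hp.2) (abs_cosTransform_le hKi _)
    (abs_nonneg _) (by positivity)

/-- **The high band is free (abstract form).**  For `K` measurable, `L¹(0,∞)`, `|K| ≤ B₀`, positive-
definite in Fejér form, and `t ≥ 0`:
`∫_{(1,∞)} (1 − cos ωt) ω⁻² D_K(ω) dω ≥ −16 c₁ B₀`, `D_K(ω) = ∫_{(0,∞)} (1 − cos ωu) K(u) du`,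
uniformly in everything but `B₀`. [folklore] -/
theorem highBand_spectral_ge {B₀ : ℝ} (hKb : ∀ u, |K u| ≤ B₀)
    (hpos : ∀ ω t : ℝ, 0 ≤ t → 0 ≤ ∫ r in (0 : ℝ)..t, (t - r) * (Real.cos (ω * r) * K r))
    {t : ℝ} (ht : 0 ≤ t) :
    -(16 * (∫ ω in Ioi (0 : ℝ), (1 - Real.cos ω) / ω ^ 2) * B₀) ≤
      ∫ ω in Ioi 1, (1 - Real.cos (ω * t)) / ω ^ 2 *
        ∫ u in Ioi 0, (1 - Real.cos (ω * u)) * K u := by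
  set c₁ : ℝ := ∫ ω in Ioi (0 : ℝ), (1 - Real.cos ω) / ω ^ 2 with hc₁
  have hc₁0 : 0 < c₁ := integral_one_sub_cos_div_sq_pos
  set Ch : ℝ → ℝ := fun ω => ∫ u in Ioi 0, Real.cos (ω * u) * K u with hCh
  have hCh0 : ∀ ω, 0 ≤ Ch ω := cosTransform_nonneg_of_lagIntegral_nonneg hKi hKm hKb hpos
  have hChm : Measurable Ch := measurable_cosTransform hKm
  have hB0 : 0 ≤ B₀ := (abs_nonneg _).trans (hKb 0)
  set L : ℝ := ∫ u in Ioi 0, |K u| with hL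
  have hChL : ∀ ω, |Ch ω| ≤ L := abs_cosTransform_le hKi
  have hI0 : 0 ≤ ∫ u in Ioi 0, K u := by simpa [hCh] using hCh0 0
  -- the two frequency windows
  set F : ℝ → ℝ := fun ω => (1 - Real.cos (ω * t)) / ω ^ 2 with hF
  have hF0 : ∀ ω, 0 ≤ F ω := fun ω => div_nonneg (one_sub_cos_mem_Icc _).1 (sq_nonneg _)
  have hFle : ∀ ω, F ω ≤ 2 / ω ^ 2 := fun ω =>
    div_le_div_of_nonneg_right (one_sub_cos_mem_Icc _).2 (sq_nonneg _)
  have hFi : IntegrableOn F (Ioi 1) :=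
    (integrableOn_one_sub_cos_mul_div_sq ht).mono_set (Ioi_subset_Ioi zero_le_one)
  have hFc : Continuous fun ω : ℝ => 1 - Real.cos (ω * t) := by fun_prop
  -- integrability on `(1,∞)` of `F·Ch` and of `Ch/ω²`
  have hFCi : IntegrableOn (fun ω => F ω * Ch ω) (Ioi 1) := by
    have h := Integrable.bdd_mul (c := L) hFi hChm.aestronglyMeasurable.restrict
      (Eventually.of_forall fun ω => by rw [Real.norm_eq_abs]; exact hChL ω)
    exact h.congr (Eventually.of_forall fun ω => mul_comm _ _)
  have hWCi : IntegrableOn (fun ω => 1 / ω ^ 2 * Ch ω) (Ioi 1) := by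
    have h := Integrable.bdd_mul (c := L) integrableOn_Ioi_one_div_sq
      hChm.aestronglyMeasurable.restrict
      (Eventually.of_forall fun ω => by rw [Real.norm_eq_abs]; exact hChL ω)
    exact h.congr (Eventually.of_forall fun ω => mul_comm _ _)
  -- Step A: `∫_{(1,∞)} Ch/ω² ≤ 8 c₁ B₀` by the Fejér average over `s ∈ (0,2]`
  have hInt := integrable_fejerAverage hKm hKi
  -- the `s`-side function `T_s = ∫ (1 − cos ωs) ω⁻² Ch(ω) dω` and its bound
  have hTs : ∀ s ∈ Ioc (0 : ℝ) 2,
      (∫ ω in Ioi (0 : ℝ), (1 - Real.cos (ω * s)) / ω ^ 2 * Ch ω) ≤ 4 * c₁ * B₀ := by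
    intro s hs
    have hid := integral_fejer_mul_cosTransform hKm hKi hs.1.le
    rw [hid]
    have hb : |∫ u in (0 : ℝ)..s, (s - u) * K u| ≤ s * B₀ * |s - 0| := by
      rw [← Real.norm_eq_abs]
      refine intervalIntegral.norm_integral_le_of_norm_le_const fun u hu => ?_
      rw [Set.uIoc_of_le hs.1.le] at hu
      rw [Real.norm_eq_abs, abs_mul, abs_of_nonneg (by linarith [hu.2] : 0 ≤ s - u)]
      exact mul_le_mul (by linarith [hu.1]) (hKb u) (abs_nonneg _) hs.1.le
    rw [sub_zero, abs_of_pos hs.1] at hb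
    have hs4 : s * B₀ * s ≤ 4 * B₀ := by
      have hs2 : s * s ≤ 4 := by nlinarith [hs.1, hs.2]
      calc s * B₀ * s = s * s * B₀ := by ring
        _ ≤ 4 * B₀ := mul_le_mul_of_nonneg_right hs2 hB0
    calc c₁ * ∫ u in (0 : ℝ)..s, (s - u) * K u ≤ c₁ * |∫ u in (0 : ℝ)..s, (s - u) * K u| :=
          mul_le_mul_of_nonneg_left (le_abs_self _) hc₁0.le
      _ ≤ c₁ * (4 * B₀) := mul_le_mul_of_nonneg_left (hb.trans hs4) hc₁0.le
      _ = 4 * c₁ * B₀ := by ring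
  -- Fubini
  have hswap : ∫ s in Ioc (0 : ℝ) 2, ∫ ω in Ioi (0 : ℝ), (1 - Real.cos (ω * s)) / ω ^ 2 * Ch ω =
      ∫ ω in Ioi (0 : ℝ), ∫ s in Ioc (0 : ℝ) 2, (1 - Real.cos (ω * s)) / ω ^ 2 * Ch ω :=
    integral_integral_swap hInt
  -- the `ω`-side function and its properties
  have hWi : IntegrableOn (fun ω => ∫ s in Ioc (0 : ℝ) 2, (1 - Real.cos (ω * s)) / ω ^ 2 * Ch ω)
      (Ioi 0) := hInt.swap.integral_prod_left
  have hW0 : ∀ ω, 0 ≤ ∫ s in Ioc (0 : ℝ) 2, (1 - Real.cos (ω * s)) / ω ^ 2 * Ch ω := fun ω =>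
    setIntegral_nonneg measurableSet_Ioc fun s _ =>
      mul_nonneg (div_nonneg (one_sub_cos_mem_Icc _).1 (sq_nonneg _)) (hCh0 ω)
  have hWge : ∀ ω ∈ Ioi (1 : ℝ),
      1 / ω ^ 2 * Ch ω ≤ ∫ s in Ioc (0 : ℝ) 2, (1 - Real.cos (ω * s)) / ω ^ 2 * Ch ω := by
    intro ω hω
    have hω0 : ω ≠ 0 := by intro h; rw [h] at hω; exact absurd hω (by norm_num)
    rw [integral_mul_const, integral_Ioc_fejerWeight hω0]
    refine mul_le_mul_of_nonneg_right ?_ (hCh0 ω)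
    exact div_le_div_of_nonneg_right (one_le_two_sub_sin_div hω.le) (sq_nonneg _)
  have hA : ∫ ω in Ioi (1 : ℝ), 1 / ω ^ 2 * Ch ω ≤ 8 * c₁ * B₀ := by
    calc ∫ ω in Ioi (1 : ℝ), 1 / ω ^ 2 * Ch ω
        ≤ ∫ ω in Ioi (1 : ℝ), ∫ s in Ioc (0 : ℝ) 2, (1 - Real.cos (ω * s)) / ω ^ 2 * Ch ω :=
          setIntegral_mono_on hWCi (hWi.mono_set (Ioi_subset_Ioi zero_le_one)) measurableSet_Ioi
            hWge
      _ ≤ ∫ ω in Ioi (0 : ℝ), ∫ s in Ioc (0 : ℝ) 2, (1 - Real.cos (ω * s)) / ω ^ 2 * Ch ω :=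
          setIntegral_mono_set hWi (Eventually.of_forall hW0)
            (Eventually.of_forall (Ioi_subset_Ioi zero_le_one))
      _ = ∫ s in Ioc (0 : ℝ) 2, ∫ ω in Ioi (0 : ℝ), (1 - Real.cos (ω * s)) / ω ^ 2 * Ch ω :=
          hswap.symm
      _ ≤ ∫ s in Ioc (0 : ℝ) 2, 4 * c₁ * B₀ :=
          setIntegral_mono_on hInt.integral_prod_left (integrableOn_const (by simp))
            measurableSet_Ioc hTs
      _ = 8 * c₁ * B₀ := by
          rw [setIntegral_const, Real.volume_real_Ioc_of_le (by norm_num : (0 : ℝ) ≤ 2),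
            smul_eq_mul]
          ring
  -- Step B: split `D = I₀ − Ch` on the high band
  have hD : ∀ ω, ∫ u in Ioi 0, (1 - Real.cos (ω * u)) * K u = (∫ u in Ioi 0, K u) - Ch ω :=
    dip_eq_sub_cosTransform hKi
  simp_rw [hD, mul_sub]
  rw [integral_sub (hFi.mul_const _) hFCi, integral_mul_const]
  have h1 : 0 ≤ (∫ ω in Ioi (1 : ℝ), F ω) * ∫ u in Ioi 0, K u :=
    mul_nonneg (setIntegral_nonneg measurableSet_Ioi fun ω _ => hF0 ω) hI0
  have h2 : ∫ ω in Ioi (1 : ℝ), F ω * Ch ω ≤ 2 * ∫ ω in Ioi (1 : ℝ), 1 / ω ^ 2 * Ch ω := by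
    rw [← integral_const_mul]
    refine setIntegral_mono_on hFCi (hWCi.const_mul 2) measurableSet_Ioi fun ω _ => ?_
    calc F ω * Ch ω ≤ 2 / ω ^ 2 * Ch ω := mul_le_mul_of_nonneg_right (hFle ω) (hCh0 ω)
      _ = 2 * (1 / ω ^ 2 * Ch ω) := by ring
  change -(16 * c₁ * B₀) ≤ (∫ ω in Ioi (1 : ℝ), F ω) * (∫ u in Ioi 0, K u) -
    ∫ ω in Ioi (1 : ℝ), F ω * Ch ω
  linarith [hA, h1, h2]

end HighBandFree

end Summit.AtomisticToContinuum.FouriersLaw.Theorems.BoundedResponse.TransientBand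

end
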